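import Mathlib.RingTheory.Derivation.Basic
import Mathlib.Algebra.CharP.Defs
import Mathlib.Algebra.Module.BigOperators
import Mathlib.Algebra.BigOperators.Intervals
import Mathlib.Algebra.Order.Interval.Finset.SuccPred
import Mathlib.Data.Nat.Choose.Sum
import Mathlib.Data.Nat.Choose.Dvd
import Mathlib.Tactic.Module
import HarnessLib

/-!
# The additivity identity behind the inverse Cartier operator:
# `(a+b)^{p-1} d(a+b) − a^{p-1} da − b^{p-1} db` is exact

Let `p` be a prime and let `S_p(X, Y) = ((X + Y)^p − X^p − Y^p) / p ∈ ℤ[X, Y]` be the integer polynomial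
`S_p = ∑_{0 < k < p} (C(p, k) / p) · X^k Y^{p-k}` (the binomial coefficients `C(p, k)`, `0 < k < p`, are
divisible by `p`).  For every derivation `D : R → M` on a commutative ring `R` (no characteristic
hypothesis is needed for the identity itself) one has

  `D (S_p(a, b)) = ((a+b)^{p-1} − a^{p-1}) · Da + ((a+b)^{p-1} − b^{p-1}) · Db`
  `             = (a+b)^{p-1} · D(a+b) − a^{p-1} · Da − b^{p-1} · Db`,

because `∂S_p/∂X = (X+Y)^{p-1} − X^{p-1}` and `∂S_p/∂Y = (X+Y)^{p-1} − Y^{p-1}`; coefficientwise this is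
`(C(p, k) / p) · k = C(p-1, k-1)` and `(C(p, k) / p) · (p − k) = C(p-1, k)` for `0 < k < p`
(`addPowDeriv_choose_div_mul_succ`, `addPowDeriv_choose_div_mul_sub`).

In characteristic `p` this is the classical computation [cite: GilleSzamuely2017, Lemma 9.2.1] showing that
the map `a ↦ a^{p-1} da : K → Ω¹_K` is additive modulo exact forms `B¹_K = dK`, hence induces a
well-defined additive (`p`-linear) map `K → Ω¹_K / B¹_K` — the inverse Cartier operator `γ` in degree one
(P. Gille, T. Szamuely, *Central simple algebras and Galois cohomology*, 2nd ed., Lemma 9.2.1 and §9.4).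

Main statements:

* `addPowDeriv_apply_sum_choose_div` — the explicit identity
  `D (∑_{0<k<p} (C(p,k)/p) a^k b^{p-k}) = (a+b)^{p-1} • D(a+b) − a^{p-1} • Da − b^{p-1} • Db`;
* `Derivation.exists_apply_eq_add_pow_sub` — the existence form
  `∃ s, D s = (a+b)^{p-1} • D(a+b) − a^{p-1} • Da − b^{p-1} • Db` used to define `γ`.

Everything is proved; no named fact.

## References

* P. Gille, T. Szamuely, *Central simple algebras and Galois cohomology*, 2nd ed., Cambridge Studies in
  Advanced Mathematics 165, CUP 2017, Lemma 9.2.1, §9.4. [GilleSzamuely2017]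
-/

namespace Literature.NumberTheory.GaloisCohomology

universe u v

open Finset

/-- For a prime `p` and `0 < j + 1 < p`: `(C(p, j+1) / p) · (j + 1) = C(p-1, j)` (exact division, as
`p ∣ C(p, j+1)`); this is the coefficient identity behind `∂S_p/∂X = (X+Y)^{p-1} − X^{p-1}`. [folklore] -/
theorem addPowDeriv_choose_div_mul_succ {p : ℕ} (hp : p.Prime) {j : ℕ} (hj : j + 1 < p) :
    p.choose (j + 1) / p * (j + 1) = (p - 1).choose j := by
  have hdvd : p ∣ p.choose (j + 1) := hp.dvd_choose_self (Nat.succ_ne_zero j) hj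
  have h := Nat.add_one_mul_choose_eq (p - 1) j
  rw [Nat.sub_add_cancel hp.one_le] at h
  -- `h : p * (p - 1).choose j = p.choose (j + 1) * (j + 1)`
  refine Nat.eq_of_mul_eq_mul_left hp.pos ?_
  rw [← mul_assoc, Nat.mul_div_cancel' hdvd, h]

/-- For a prime `p` and `j + 1 < p`: `(C(p, j+1) / p) · (p - 1 - j) = C(p-1, j+1)` (exact division, as
`p ∣ C(p, j+1)`); this is the coefficient identity behind `∂S_p/∂Y = (X+Y)^{p-1} − Y^{p-1}`. [folklore] -/
theorem addPowDeriv_choose_div_mul_sub {p : ℕ} (hp : p.Prime) {j : ℕ} (hj : j + 1 < p) :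
    p.choose (j + 1) / p * (p - 1 - j) = (p - 1).choose (j + 1) := by
  have hdvd : p ∣ p.choose (j + 1) := hp.dvd_choose_self (Nat.succ_ne_zero j) hj
  have h := Nat.choose_mul_succ_eq (p - 1) (j + 1)
  rw [Nat.sub_add_cancel hp.one_le] at h
  -- `h : (p - 1).choose (j + 1) * p = p.choose (j + 1) * (p - (j + 1))`
  refine Nat.eq_of_mul_eq_mul_left hp.pos ?_
  rw [← mul_assoc, Nat.mul_div_cancel' hdvd, show p - 1 - j = p - (j + 1) by omega, ← h]
  exact Nat.mul_comm _ _

/-- The `Da`-coefficient of `D(S_p(a,b))`: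
`∑_{j < p-1} (C(p, j+1)/p) (j+1) a^j b^{p-1-j} = (a+b)^{p-1} − a^{p-1}`. [folklore] -/
theorem addPowDeriv_sum_fst {R : Type u} [CommRing R] {p : ℕ} (hp : p.Prime) (a b : R) :
    ∑ j ∈ range (p - 1), ((p.choose (j + 1) / p : ℕ) : R) * ((j + 1 : ℕ) : R) *
        (a ^ j * b ^ (p - 1 - j)) = (a + b) ^ (p - 1) - a ^ (p - 1) := by
  rw [add_pow, Finset.sum_range_succ, Nat.sub_self, pow_zero, mul_one, Nat.choose_self, Nat.cast_one,
    mul_one, add_sub_cancel_right]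
  refine Finset.sum_congr rfl fun j hj => ?_
  rw [Finset.mem_range] at hj
  rw [← Nat.cast_mul, addPowDeriv_choose_div_mul_succ hp (by omega)]
  ring

/-- The `Db`-coefficient of `D(S_p(a,b))`:
`∑_{j < p-1} (C(p, j+1)/p) (p-1-j) a^{j+1} b^{p-2-j} = (a+b)^{p-1} − b^{p-1}`. [folklore] -/
theorem addPowDeriv_sum_snd {R : Type u} [CommRing R] {p : ℕ} (hp : p.Prime) (a b : R) :
    ∑ j ∈ range (p - 1), ((p.choose (j + 1) / p : ℕ) : R) * ((p - 1 - j : ℕ) : R) *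
        (a ^ (j + 1) * b ^ (p - 1 - j - 1)) = (a + b) ^ (p - 1) - b ^ (p - 1) := by
  rw [add_pow, Finset.sum_range_succ', pow_zero, one_mul, Nat.sub_zero, Nat.choose_zero_right,
    Nat.cast_one, mul_one, add_sub_cancel_right]
  refine Finset.sum_congr rfl fun j hj => ?_
  rw [Finset.mem_range] at hj
  rw [← Nat.cast_mul, addPowDeriv_choose_div_mul_sub hp (by omega), Nat.sub_add_eq]
  ring

/-- **`D(S_p(a,b))`, summed over `range (p-1)`.**  For every derivation `D` of a commutative ring `R`
(over `ℤ`) into an `R`-module and all `a b : R`,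
`D (∑_{j<p-1} (C(p, j+1)/p) · a^{j+1} b^{p-1-j}) = (a+b)^{p-1} • D(a+b) − a^{p-1} • Da − b^{p-1} • Db`.
[cite: GilleSzamuely2017, Lemma 9.2.1] -/
theorem addPowDeriv_apply_sum_range {R : Type u} [CommRing R] {p : ℕ} (hp : p.Prime)
    {M : Type v} [AddCommGroup M] [Module R M] (D : Derivation ℤ R M) (a b : R) :
    D (∑ j ∈ range (p - 1), ((p.choose (j + 1) / p : ℕ) : R) * (a ^ (j + 1) * b ^ (p - 1 - j))) =
      (a + b) ^ (p - 1) • D (a + b) - a ^ (p - 1) • D a - b ^ (p - 1) • D b := by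
  have key : ∀ j ∈ range (p - 1),
      D (((p.choose (j + 1) / p : ℕ) : R) * (a ^ (j + 1) * b ^ (p - 1 - j))) =
        (((p.choose (j + 1) / p : ℕ) : R) * ((j + 1 : ℕ) : R) * (a ^ j * b ^ (p - 1 - j))) • D a +
          (((p.choose (j + 1) / p : ℕ) : R) * ((p - 1 - j : ℕ) : R) *
            (a ^ (j + 1) * b ^ (p - 1 - j - 1))) • D b := by
    intro j _
    rw [Derivation.leibniz, Derivation.map_natCast, smul_zero, add_zero, Derivation.leibniz,
      Derivation.leibniz_pow, Derivation.leibniz_pow, Nat.add_sub_cancel,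
      ← Nat.cast_smul_eq_nsmul R (j + 1), ← Nat.cast_smul_eq_nsmul R (p - 1 - j)]
    module
  calc D (∑ j ∈ range (p - 1), ((p.choose (j + 1) / p : ℕ) : R) * (a ^ (j + 1) * b ^ (p - 1 - j)))
      = ∑ j ∈ range (p - 1),
          ((((p.choose (j + 1) / p : ℕ) : R) * ((j + 1 : ℕ) : R) * (a ^ j * b ^ (p - 1 - j))) • D a +
            (((p.choose (j + 1) / p : ℕ) : R) * ((p - 1 - j : ℕ) : R) *
              (a ^ (j + 1) * b ^ (p - 1 - j - 1))) • D b) := by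
        rw [map_sum]
        exact Finset.sum_congr rfl key
    _ = (∑ j ∈ range (p - 1), ((p.choose (j + 1) / p : ℕ) : R) * ((j + 1 : ℕ) : R) *
            (a ^ j * b ^ (p - 1 - j))) • D a +
          (∑ j ∈ range (p - 1), ((p.choose (j + 1) / p : ℕ) : R) * ((p - 1 - j : ℕ) : R) *
            (a ^ (j + 1) * b ^ (p - 1 - j - 1))) • D b := by
        rw [Finset.sum_add_distrib, Finset.sum_smul, Finset.sum_smul]
    _ = (a + b) ^ (p - 1) • D (a + b) - a ^ (p - 1) • D a - b ^ (p - 1) • D b := by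
        rw [addPowDeriv_sum_fst hp, addPowDeriv_sum_snd hp, map_add]
        module

/-- **The identity `D(S_p(a,b)) = (a+b)^{p-1} D(a+b) − a^{p-1} Da − b^{p-1} Db`** with the explicit witness
`S_p(a, b) = ∑_{0 < k < p} (C(p, k)/p) · a^k b^{p-k}`: for every derivation `D` of a commutative ring `R` into
an `R`-module, `D (S_p(a,b)) = (a+b)^{p-1} • D(a+b) − a^{p-1} • Da − b^{p-1} • Db`.  In characteristic `p`
this says `a ↦ a^{p-1} da` is additive modulo exact forms (Gille–Szamuely, Lemma 9.2.1: the inverse Cartier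
operator on `Ω¹/B¹` is well defined and additive). [cite: GilleSzamuely2017, Lemma 9.2.1] -/
theorem addPowDeriv_apply_sum_choose_div {R : Type u} [CommRing R] (p : ℕ) [Fact p.Prime]
    {M : Type v} [AddCommGroup M] [Module R M] (D : Derivation ℤ R M) (a b : R) :
    D (∑ k ∈ Finset.Ioo 0 p, ((p.choose k / p : ℕ) : R) * a ^ k * b ^ (p - k)) =
      (a + b) ^ (p - 1) • D (a + b) - a ^ (p - 1) • D a - b ^ (p - 1) • D b := by
  have hp : p.Prime := Fact.out
  have h : ∑ k ∈ Finset.Ioo 0 p, ((p.choose k / p : ℕ) : R) * a ^ k * b ^ (p - k) =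
      ∑ j ∈ range (p - 1), ((p.choose (j + 1) / p : ℕ) : R) * (a ^ (j + 1) * b ^ (p - 1 - j)) := by
    rw [← Finset.Ico_add_one_left_eq_Ioo, Finset.sum_Ico_eq_sum_range, zero_add]
    refine Finset.sum_congr rfl fun j _ => ?_
    rw [Nat.add_comm 1 j, show p - (j + 1) = p - 1 - j by omega, mul_assoc]
  rw [h]
  exact addPowDeriv_apply_sum_range hp D a b

/-- **Additivity of `a ↦ a^{p-1} da` modulo exact forms** (the computation behind the inverse Cartier
operator, Gille–Szamuely Lemma 9.2.1): for a commutative ring `R` of prime characteristic `p`, a derivation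
`D : R → M` over `ℤ` and `a b : R`, the element `(a+b)^{p-1} • D(a+b) − a^{p-1} • Da − b^{p-1} • Db` is of
the form `D s` — namely `s = S_p(a, b) = ∑_{0<k<p} (C(p,k)/p) a^k b^{p-k}`
(`addPowDeriv_apply_sum_choose_div`). [cite: GilleSzamuely2017, Lemma 9.2.1] -/
theorem Derivation.exists_apply_eq_add_pow_sub {R : Type u} [CommRing R] (p : ℕ) [Fact p.Prime] [CharP R p]
    {M : Type v} [AddCommGroup M] [Module R M] (D : Derivation ℤ R M) (a b : R) :
    ∃ s : R, D s = (a + b) ^ (p - 1) • D (a + b) - a ^ (p - 1) • D a - b ^ (p - 1) • D b :=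
  ⟨_, addPowDeriv_apply_sum_choose_div p D a b⟩

end Literature.NumberTheory.GaloisCohomology
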